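import Summits.AtomisticToContinuum.Crystallization.Theorems.ExcessDecayLiouvilleForceBalance
import Summits.AtomisticToContinuum.Crystallization.Theorems.ExcessDecayLiouvilleGrainsGlueField
import Summits.AtomisticToContinuum.Crystallization.Theorems.ExcessDecayLiouvilleGrainsGlueNearLimit
import Literature.MathematicalPhysics.StatisticalMechanics.CrystallizationSymmetries

/-!
# `ExcessDecayLiouville.GrainsGlue`: coarse grains + coarse Liouville + phonon stability ⇒ fine grains

Route `ExcessDecayLiouville` (sub-problem `Crystallization`), support item
`stmt-AtomisticToContinuum-9336`: `GrainsGlue : PhononStability → HcpLiouville → CoarseGrains →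
FineGrains`, the compactness-and-contradiction glue of the route (setting: BlancLewin2015 §2.1–2.2;
folklore argument).  Helper files `…GrainsGlueField`, `…GrainsGlueNearLimit`.

* `hasSum_force_of_forall_exists_ballMatch` — force balance passes to local limits (far field
  uniformly `≤ 500 δ⁻⁶/L`; near field a finite sum, continuous in the positions; the force balance of
  a matched finite set splits accordingly by two-way matching + separation).
* `grainsGlue_proof` — the item.  If fine grains fail at `(ρ, ε)`, `CoarseGrains` at radius `k + 2`
  still gives the bad ground states coarse grains; re-centred at a nearby site (`exists_site_near`;
  translates of ground states are ground states) their particle sets `Y_k` are `δ`-separated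
  (`LennardJonesMinimalDistance_holds`), force balanced (`ExcessDecayLiouvilleForceBalance`, item
  9335), `1/40`-matched on `‖·‖ ≤ k` with data in a compact set; a local limit `Y`
  (`exists_subseq_forall_eventually_ballMatch`) with limit data `(t, A)` is separated, force
  balanced, globally `1/40`-matched (`near_of_limit`), `A` admissible, `Inner t A`; `HcpLiouville`
  (its stability hypothesis is literally `PhononStability`) makes `Y` an exact admissible two-lattice,
  and matching `Y_k` with `Y` at tolerance `ε` on `‖·‖ ≤ ρ` is a fine matching: contradiction.
-/

noncomputable section

open scoped BigOperators Topology
open Filter Metric Literature.MathematicalPhysics.StatisticalMechanics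
open Summit.AtomisticToContinuum.Crystallization.Theorems.CoarseGrains.Negative.PredicateAPI

namespace Summit.AtomisticToContinuum.Crystallization.Theorems

namespace ExcessDecayLiouvilleGrainsGlue

/-! ### Force balance: finite ground states and local limits -/

/-- **Force balance, point-set form** (from `ExcessDecayLiouvilleForceBalance.sum_erase_force_eq_zero`,
item 9335): for a Lennard-Jones ground state `x` with particle set `X = Finset.univ.image x`, at every
`p ∈ X` the finite sum over `q ∈ X ∖ {p}` of `(V′(|p − q|)/|p − q|)(p − q)` is `0`.
[cite: BlancLewin2015, §1.2] -/
theorem sum_force_eq_zero_finset {d N : ℕ} {x : Fin N → EuclideanSpace ℝ (Fin d)}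
    (hx : IsGroundState lennardJones x) {p : EuclideanSpace ℝ (Fin d)}
    (hp : p ∈ Finset.univ.image x) :
    ∑ q ∈ (Finset.univ.image x).erase p,
      (deriv lennardJones (dist p q) / dist p q) • (p - q) = 0 := by
  classical
  obtain ⟨i, -, rfl⟩ := Finset.mem_image.1 hp
  have himg : (Finset.univ.image x).erase (x i) = (Finset.univ.erase i).image x := by
    rw [Finset.image_erase hx.1]
  rw [himg, Finset.sum_image fun a _ b _ h => hx.1 h]
  exact ExcessDecayLiouvilleForceBalance.sum_erase_force_eq_zero hx i

/-- **Force balance passes to local limits.** If `Y ⊆ ℝ³` is `δ`-separated (`0 < δ ≤ 1`) and for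
every `R` and `ε > 0` some finite `δ`-separated force-balanced point set is two-way `ε`-matched with
`Y` on the ball `‖·‖ ≤ R`, then the Lennard-Jones force on every point of `Y` has sum `0`
(`HasSum` over `{q ∈ Y, q ≠ p}`, absolutely convergent). [folklore] -/
theorem hasSum_force_of_forall_exists_ballMatch {δ : ℝ} (hδ : 0 < δ) (hδ1 : δ ≤ 1) {Y : Set E3}
    (hsep : ∀ p ∈ Y, ∀ q ∈ Y, p ≠ q → δ ≤ dist p q)
    (happrox : ∀ R ε : ℝ, 0 < ε → ∃ X : Finset E3,
        (∀ p ∈ X, ∀ q ∈ X, p ≠ q → δ ≤ dist p q) ∧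
        (∀ p ∈ X, ∑ q ∈ X.erase p, (deriv lennardJones (dist p q) / dist p q) • (p - q) = 0) ∧
        BallMatch ε R 0 (↑X : Set E3) Y)
    {p : E3} (hp : p ∈ Y) :
    HasSum (fun q : {q : E3 // q ∈ Y ∧ q ≠ p} =>
      (deriv lennardJones (dist p q.1) / dist p q.1) • (p - q.1)) 0 := by
  classical
  set f : {q : E3 // q ∈ Y ∧ q ≠ p} → E3 := fun q =>
    (deriv lennardJones (dist p q.1) / dist p q.1) • (p - q.1) with hf
  have hsumm : Summable f := summable_force hδ hsep hp
  suffices h0 : ∑' q, f q = 0 by rw [← h0]; exact hsumm.hasSum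
  rw [← norm_le_zero_iff]
  refine le_of_forall_pos_le_add fun η hη => ?_
  rw [zero_add]
  -- the splitting radius `L`
  obtain ⟨L, hL2, hLtail⟩ : ∃ L : ℝ, 2 ≤ L ∧ 500 * δ⁻¹ ^ 6 / (L - 1) ≤ η / 3 := by
    have hpos : 0 < 1500 * δ⁻¹ ^ 6 / η := by positivity
    refine ⟨1500 * δ⁻¹ ^ 6 / η + 2, by linarith, ?_⟩
    rw [div_le_iff₀ (by linarith)]
    calc 500 * δ⁻¹ ^ 6 = η / 3 * (1500 * δ⁻¹ ^ 6 / η) := by field_simp; ring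
      _ ≤ η / 3 * (1500 * δ⁻¹ ^ 6 / η + 2 - 1) := by nlinarith
  have hL1' : 1 ≤ L - 1 := by linarith
  -- the near index set is finite
  set T : Set {q : E3 // q ∈ Y ∧ q ≠ p} := {q | dist p q.1 < L} with hT
  have hTfin : T.Finite := by
    have hfin : (Y ∩ closedBall p L).Finite :=
      finite_of_forall_le_dist_of_subset_closedBall hδ
        (fun a ha b hb hab => hsep a ha.1 b hb.1 hab) Set.inter_subset_right
    have hpre : (Subtype.val ⁻¹' (Y ∩ closedBall p L) : Set {q : E3 // q ∈ Y ∧ q ≠ p}).Finite :=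
      hfin.preimage Subtype.val_injective.injOn
    refine hpre.subset fun q hq => ⟨q.2.1, ?_⟩
    rw [mem_closedBall, dist_comm]
    exact le_of_lt hq
  set s : Finset {q : E3 // q ∈ Y ∧ q ≠ p} := hTfin.toFinset with hs_def
  have hs : ∀ q, dist p q.1 < L → q ∈ s := fun q hq => hTfin.mem_toFinset.2 hq
  have hs' : ∀ q ∈ s, dist p q.1 < L := fun q hq => hTfin.mem_toFinset.1 hq
  -- far part
  have hsplit := hsumm.sum_add_tsum_subtype_compl s
  have hfar : ‖∑' q : {q : {q : E3 // q ∈ Y ∧ q ≠ p} // q ∉ s}, f q.1‖ ≤ η / 3 :=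
    (norm_tsum_force_compl_le hδ hδ1 (by linarith) hsep hp s hs).trans
      ((div_le_div_of_nonneg_left (by positivity) (by linarith) (by linarith)).trans hLtail)
  -- near part: continuity of the finite force sum at the limit positions
  set v₀ : E3 × (↥s → E3) := (p, fun i => i.1.1) with hv₀
  have hv₀ne : ∀ i : ↥s, v₀.1 ≠ v₀.2 i := fun i => Ne.symm i.1.2.2
  have hcont := continuousAt_sum_force hv₀ne
  obtain ⟨γ, hγ, hγc⟩ := Metric.continuousAt_iff.1 hcont (η / 3) (by positivity)
  have hΦ₀ : ∑ i : ↥s, (deriv lennardJones (dist v₀.1 (v₀.2 i)) / dist v₀.1 (v₀.2 i)) • (v₀.1 - v₀.2 i) =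
      ∑ q ∈ s, f q := by
    rw [hv₀]
    exact Finset.sum_coe_sort s f
  -- the matching scale
  set ε : ℝ := min (γ / 2) (min (δ / 4) (1 / 2)) with hε
  have hε0 : 0 < ε := by positivity
  have hεγ : ε < γ := (min_le_left _ _).trans_lt (by linarith)
  have hεδ' : ε ≤ δ / 4 := (min_le_right _ _).trans (min_le_left _ _)
  have hε1' : ε ≤ 1 / 2 := (min_le_right _ _).trans (min_le_right _ _)
  have hεδ : 4 * ε ≤ δ := by linarith
  have hε1 : 2 * ε ≤ 1 := by linarith
  set R : ℝ := ‖p‖ + L + 1 with hR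
  obtain ⟨X, hXsep, hXbal, hBM⟩ := happrox R ε hε0
  obtain ⟨hBM1, hBM2⟩ := hBM
  -- the matching map `τ`
  choose! τ hτX hτd using hBM1
  have hpR : dist p 0 ≤ R := by rw [dist_zero_right, hR]; linarith
  have hqR : ∀ q ∈ s, dist (q : {q : E3 // q ∈ Y ∧ q ≠ p}).1 0 ≤ R := by
    intro q hq
    rw [dist_zero_right]
    have h1 : ‖q.1‖ ≤ ‖p‖ + dist p q.1 := by
      rw [dist_eq_norm]
      linarith [norm_sub_norm_le q.1 p, norm_sub_rev p q.1]
    have := hs' q hq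
    rw [hR]; linarith
  have hτp : τ p ∈ X ∧ dist (τ p) p ≤ ε := ⟨hτX p hp hpR, hτd p hp hpR⟩
  have hτq : ∀ q ∈ s, τ (q : {q : E3 // q ∈ Y ∧ q ≠ p}).1 ∈ X ∧ dist (τ q.1) q.1 ≤ ε :=
    fun q hq => ⟨hτX q.1 q.2.1 (hqR q hq), hτd q.1 q.2.1 (hqR q hq)⟩
  -- `τ` separates matched points of `Y`
  have hτinj : ∀ y ∈ Y, ∀ y' ∈ Y, dist (τ y) y ≤ ε → dist (τ y') y' ≤ ε → τ y = τ y' → y = y' := by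
    intro y hy y' hy' h1 h2 h3
    by_contra hne
    have hd := hsep y hy y' hy' hne
    have : dist y y' ≤ 2 * ε :=
      calc dist y y' ≤ dist (τ y) y + dist (τ y) y' := dist_triangle_left _ _ _
        _ ≤ ε + ε := by rw [h3]; exact add_le_add (h3 ▸ h1) h2
        _ = 2 * ε := by ring
    linarith
  set a : E3 := τ p with ha
  -- the matched particles form the image `I ⊆ X ∖ {a}`
  set I : Finset E3 := s.image fun q => τ q.1 with hI
  have hIsub : I ⊆ X.erase a := by
    intro b hb
    obtain ⟨q, hq, rfl⟩ := Finset.mem_image.1 hb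
    refine Finset.mem_erase.2 ⟨fun h => ?_, (hτq q hq).1⟩
    exact q.2.2 (hτinj q.1 q.2.1 p hp (hτq q hq).2 hτp.2 h)
  have hinjs : Set.InjOn (fun q : {q : E3 // q ∈ Y ∧ q ≠ p} => τ q.1) s := by
    intro q hq q' hq' h
    exact Subtype.ext (hτinj q.1 q.2.1 q'.1 q'.2.1 (hτq q hq).2 (hτq q' hq').2 h)
  -- force balance at `a`, split along `I`
  have hbal := hXbal a hτp.1
  rw [← Finset.sum_sdiff hIsub] at hbal
  have hsumI : ∑ b ∈ I, (deriv lennardJones (dist a b) / dist a b) • (a - b) =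
      ∑ i : ↥s, (deriv lennardJones (dist a (τ i.1.1)) / dist a (τ i.1.1)) • (a - τ i.1.1) := by
    rw [hI, Finset.sum_image hinjs]
    exact (Finset.sum_coe_sort s (fun q =>
      (deriv lennardJones (dist a (τ q.1)) / dist a (τ q.1)) • (a - τ q.1))).symm
  -- the remainder is far from `a`
  have hfarX : ∀ b ∈ X.erase a \ I, L - 1 ≤ dist a b := by
    intro b hb
    obtain ⟨hb1, hbI⟩ := Finset.mem_sdiff.1 hb
    obtain ⟨hba, hbX⟩ := Finset.mem_erase.1 hb1
    by_contra hlt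
    rw [not_le] at hlt
    have hbR : dist b 0 ≤ R := by
      rw [dist_zero_right]
      have h1 : ‖b‖ ≤ ‖a‖ + dist a b := by
        rw [dist_eq_norm]; linarith [norm_sub_norm_le b a, norm_sub_rev a b]
      have h2 : ‖a‖ ≤ ‖p‖ + dist a p := by
        rw [dist_eq_norm]; linarith [norm_sub_norm_le a p]
      rw [hR]; linarith [hτp.2]
    obtain ⟨y, hy, hby⟩ := hBM2 b hbX hbR
    have hya : y ≠ p := by
      intro hyp
      rw [hyp] at hby
      have hd := hXsep a hτp.1 b hbX (Ne.symm hba)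
      have : dist a b ≤ 2 * ε :=
        calc dist a b ≤ dist a p + dist b p := dist_triangle_right _ _ _
          _ ≤ ε + ε := add_le_add hτp.2 hby
          _ = 2 * ε := by ring
      linarith
    have hyL : dist p y < L :=
      calc dist p y ≤ dist p a + dist a b + dist b y := dist_triangle4 _ _ _ _
        _ < ε + (L - 1) + ε := by
            rw [dist_comm p a]
            linarith [hτp.2]
        _ ≤ L := by linarith
    have hys : (⟨y, hy, hya⟩ : {q : E3 // q ∈ Y ∧ q ≠ p}) ∈ s := hs ⟨y, hy, hya⟩ hyL
    have hτy := hτq _ hys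
    have hbτ : b = τ y := by
      by_contra hne
      have hd := hXsep b hbX (τ y) hτy.1 hne
      have : dist b (τ y) ≤ 2 * ε :=
        calc dist b (τ y) ≤ dist b y + dist (τ y) y := dist_triangle_right _ _ _
          _ ≤ ε + ε := add_le_add hby hτy.2
          _ = 2 * ε := by ring
      linarith
    exact hbI (Finset.mem_image.2 ⟨⟨y, hy, hya⟩, hys, hbτ.symm⟩)
  have hrest : ‖∑ b ∈ X.erase a \ I, (deriv lennardJones (dist a b) / dist a b) • (a - b)‖ ≤ η / 3 := by
    refine (norm_sum_le _ _).trans ((sum_norm_force_le_of_far _ a hδ hδ1 hL1' hfarX ?_).trans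
      hLtail)
    intro y hy y' hy' hne
    exact hXsep y (Finset.mem_of_mem_erase (Finset.mem_sdiff.1 hy).1) y'
      (Finset.mem_of_mem_erase (Finset.mem_sdiff.1 hy').1) hne
  -- hence the matched finite sum is small
  have hΦa : ‖∑ i : ↥s, (deriv lennardJones (dist a (τ i.1.1)) / dist a (τ i.1.1)) • (a - τ i.1.1)‖ ≤ η / 3 := by
    have : ∑ i : ↥s, (deriv lennardJones (dist a (τ i.1.1)) / dist a (τ i.1.1)) • (a - τ i.1.1) =
        -∑ b ∈ X.erase a \ I, (deriv lennardJones (dist a b) / dist a b) • (a - b) := by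
      rw [← hsumI]
      exact eq_neg_of_add_eq_zero_right hbal
    rw [this, norm_neg]
    exact hrest
  -- continuity transfers smallness to the limit positions
  have hclose : dist ((a, fun i : ↥s => τ i.1.1) : E3 × (↥s → E3)) v₀ < γ := by
    rw [Prod.dist_eq, hv₀]
    refine max_lt (hτp.2.trans_lt hεγ) ?_
    refine lt_of_le_of_lt ((dist_pi_le_iff hε0.le).2 fun i => (hτq i.1 i.2).2) hεγ
  have hnear : ‖∑ q ∈ s, f q‖ ≤ η / 3 + η / 3 := by
    have h1 := hγc hclose
    rw [dist_eq_norm] at h1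
    simp only at h1
    rw [hΦ₀] at h1
    calc ‖∑ q ∈ s, f q‖ = ‖∑ i : ↥s, (deriv lennardJones (dist a (τ i.1.1)) / dist a (τ i.1.1)) • (a - τ i.1.1) -
          (∑ i : ↥s, (deriv lennardJones (dist a (τ i.1.1)) / dist a (τ i.1.1)) • (a - τ i.1.1) - ∑ q ∈ s, f q)‖ := by
          rw [sub_sub_cancel]
      _ ≤ ‖∑ i : ↥s, (deriv lennardJones (dist a (τ i.1.1)) / dist a (τ i.1.1)) • (a - τ i.1.1)‖ +
          ‖∑ i : ↥s, (deriv lennardJones (dist a (τ i.1.1)) / dist a (τ i.1.1)) • (a - τ i.1.1) - ∑ q ∈ s, f q‖ :=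
        norm_sub_le _ _
      _ ≤ η / 3 + η / 3 := add_le_add hΦa h1.le
  calc ‖∑' q, f q‖ = ‖∑ q ∈ s, f q + ∑' q : {q // q ∉ s}, f q.1‖ := by rw [hsplit]
    _ ≤ ‖∑ q ∈ s, f q‖ + ‖∑' q : {q // q ∉ s}, f q.1‖ := norm_add_le _ _
    _ ≤ (η / 3 + η / 3) + η / 3 := add_le_add hnear hfar
    _ = η := by ring

end ExcessDecayLiouvilleGrainsGlue

/-! ### The theorem -/

open ExcessDecayLiouvilleGrainsGlue

/-- **`GrainsGlue` (route `ExcessDecayLiouville`, item stmt-AtomisticToContinuum-9336):**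
`PhononStability → HcpLiouville → CoarseGrains → FineGrains` — local limits of re-centred coarse
grains of Lennard-Jones ground states are separated, force-balanced and globally `1/40`-matched
with an admissible hcp datum; coarse Liouville makes them exact two-lattices, and exactness comes
back along the local convergence as fine matching. [cite: BlancLewin2015, §2.1–2.2] -/
theorem grainsGlue_proof : Theses.ExcessDecayLiouville.GrainsGlue := by
  intro hPS hHL hCG
  classical
  have hCG' := coarseGrains_iff.1 hCG
  show ∀ ρ ε : ℝ, 0 < ρ → 0 < ε → ∃ N₀ : ℕ, ∀ N : ℕ, N₀ ≤ N → ∀ x : Fin N → E3,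
    IsGroundState lennardJones x →
      ∃ (c : E3) (t : Fin 2 → E3) (A : E3 →L[ℝ] E3), Adm A ∧ Near (Set.range x) c ρ t A ε
  intro ρ ε hρ hε
  by_contra hcon
  push Not at hcon
  -- minimal distance of ground states, normalised to `δ ≤ 1`
  obtain ⟨δ₀, hδ₀, hmin⟩ := LennardJonesMinimalDistance_holds
  set δ : ℝ := min δ₀ 1 with hδ_def
  have hδ : 0 < δ := lt_min hδ₀ one_pos
  have hδ1 : δ ≤ 1 := min_le_right _ _
  have hmin' : ∀ (N : ℕ) (x : Fin N → E3), IsGroundState lennardJones x →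
      ∀ i j, i ≠ j → δ ≤ dist (x i) (x j) := fun N x hx i j hij =>
    (min_le_left _ _).trans (hmin N x hx i j hij)
  -- the bad ground states, with their coarse grains of radius `k + 2`
  choose N₀ hN₀ using fun k : ℕ => hCG' ((k : ℝ) + 2) (by positivity)
  choose N hN x hx hfail using fun k : ℕ => hcon (N₀ k)
  choose c t A hA hI hNear using fun k : ℕ => hN₀ k (N k) (hN k) (x k) (hx k)
  -- re-centre at a site `s k` near `c k`
  choose z₀ hz₀ hz₀d using fun k : ℕ => exists_site_near (hA k) (t k 0) (c k)
  set s : ℕ → E3 := fun k => t k 0 + A k (z₀ k) with hs_def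
  set y : (k : ℕ) → Fin (N k) → E3 := fun k i => x k i - s k with hy_def
  set t' : ℕ → Fin 2 → E3 := fun k m => t k m - t k 0 with ht'_def
  set Y : ℕ → Finset E3 := fun k => Finset.univ.image (y k) with hY_def
  have hYcoe : ∀ k, (↑(Y k) : Set E3) = Set.range (y k) := fun k => by
    rw [hY_def]; simp
  have hy_gs : ∀ k, IsGroundState lennardJones (y k) := fun k => by
    have : y k = fun i => x k i + -s k := by funext i; simp [hy_def, sub_eq_add_neg]
    rw [this]
    exact (isGroundState_add_const_iff lennardJones (-s k)).2 (hx k)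
  -- (1) separation
  have hsepY : ∀ k, ∀ p ∈ (↑(Y k) : Set E3), ∀ q ∈ (↑(Y k) : Set E3), p ≠ q → δ ≤ dist p q := by
    intro k p hp q hq hpq
    rw [hYcoe] at hp hq
    obtain ⟨i, rfl⟩ := hp
    obtain ⟨j, rfl⟩ := hq
    exact hmin' _ _ (hy_gs k) i j fun h => hpq (by rw [h])
  -- (2) force balance (point-set form)
  have hbalY : ∀ k, ∀ p ∈ Y k,
      ∑ q ∈ (Y k).erase p, (deriv lennardJones (dist p q) / dist p q) • (p - q) = 0 := fun k p hp =>
    sum_force_eq_zero_finset (hy_gs k) hp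
  -- (3) coarse matching on `‖·‖ ≤ k` with the re-indexed data, `t' k 0 = 0`
  have hnearY : ∀ k : ℕ, Near (↑(Y k) : Set E3) 0 k (t' k) (A k) (1 / 40) := by
    intro k
    have h1 := near_add_const (hNear k) (-s k)
    have h2 := near_reindex (hz₀ k) h1
    have himg : (fun p => p + -s k) '' Set.range (x k) = (↑(Y k) : Set E3) := by
      rw [hYcoe, ← Set.range_comp]
      rfl
    have ht : (fun m => t k m + -s k + A k (z₀ k)) = t' k := by
      funext m
      simp only [ht'_def, hs_def]
      abel
    rw [himg, ht] at h2
    refine near_of_ball_subset h2 ?_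
    have hd : dist (0 : E3) (c k + -s k) ≤ 11 / 10 := by
      rw [dist_comm, dist_eq_norm, sub_zero, ← sub_eq_add_neg, ← dist_eq_norm, dist_comm]
      exact hz₀d k
    linarith
  -- (4) inner displacement and admissibility are unchanged; (5) the data are bounded
  have hIY : ∀ k, Inner (t' k) (A k) := fun k => by
    show ‖(t k 1 - t k 0) - (t k 0 - t k 0) -
      A k (barlowOffset 1 + layerNormal (Real.sqrt (2 / 3)))‖ ≤ 1 / 40
    rw [sub_self, sub_zero]
    exact hI k
  set off : E3 := barlowOffset 1 + layerNormal (Real.sqrt (2 / 3)) with hoff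
  set Tb : ℝ := 1 / 40 + (199 / 200) * ‖off‖ with hTb
  have ht'bd : ∀ k, t' k ∈ closedBall (0 : Fin 2 → E3) Tb := by
    intro k
    rw [mem_closedBall, dist_zero_right, pi_norm_le_iff_of_nonneg (by positivity)]
    intro m
    have h0 : t' k 0 = 0 := by simp [ht'_def]
    have h1 : ‖t' k 1‖ ≤ Tb := by
      have hi : ‖t' k 1 - t' k 0 - A k off‖ ≤ 1 / 40 := hIY k
      rw [h0, sub_zero] at hi
      have hA1 := adm_norm_le (hA k) off
      calc ‖t' k 1‖ = ‖(t' k 1 - A k off) + A k off‖ := by rw [sub_add_cancel]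
        _ ≤ ‖t' k 1 - A k off‖ + ‖A k off‖ := norm_add_le _ _
        _ ≤ 1 / 40 + (199 / 200) * ‖off‖ := add_le_add hi hA1
    fin_cases m
    · simp [h0, hTb]; positivity
    · exact h1
  have hAbd : ∀ k, A k ∈ closedBall (0 : E3 →L[ℝ] E3) 1 := by
    intro k
    rw [mem_closedBall, dist_zero_right]
    refine ContinuousLinearMap.opNorm_le_bound _ zero_le_one fun v => ?_
    linarith [adm_norm_le (hA k) v, norm_nonneg v]
  -- (6) the failure of fine matching, transported to `Y k`
  have hfailY : ∀ k (tt : Fin 2 → E3) (AA : E3 →L[ℝ] E3), Adm AA →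
      ¬ Near (↑(Y k) : Set E3) 0 ρ tt AA ε := by
    intro k tt AA hAA hN
    have h1 := near_add_const hN (s k)
    have himg : (fun p => p + s k) '' (↑(Y k) : Set E3) = Set.range (x k) := by
      rw [hYcoe, ← Set.range_comp]
      congr 1
      funext i
      simp [hy_def]
    rw [himg, zero_add] at h1
    exact hfail k (s k) _ AA hAA h1
  -- local limit of the particle sets
  obtain ⟨φ₁, Yinf, hφ₁, hsepinf, hBM⟩ :=
    exists_subseq_forall_eventually_ballMatch hδ (fun k => (↑(Y k) : Set E3)) hsepY
  -- limit of the data along a further subsequence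
  have hK : IsCompact (closedBall (0 : E3 →L[ℝ] E3) 1 ×ˢ closedBall (0 : Fin 2 → E3) Tb) :=
    (isCompact_closedBall _ _).prod (isCompact_closedBall _ _)
  obtain ⟨⟨Ainf, tinf⟩, -, φ₂, hφ₂, hlim⟩ := hK.tendsto_subseq
    (x := fun k => (A (φ₁ k), t' (φ₁ k))) fun k => ⟨hAbd _, ht'bd _⟩
  set ψ : ℕ → ℕ := fun k => φ₁ (φ₂ k) with hψ_def
  have hψ : StrictMono ψ := hφ₁.comp hφ₂
  have hlimA : Tendsto (fun k => A (ψ k)) atTop (𝓝 Ainf) :=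
    (continuous_fst.tendsto _).comp hlim
  have hlimt : Tendsto (fun k => t' (ψ k)) atTop (𝓝 tinf) :=
    (continuous_snd.tendsto _).comp hlim
  have hBMψ : ∀ R η : ℝ, 0 < η → ∀ᶠ k in atTop, BallMatch η R 0 (↑(Y (ψ k)) : Set E3) Yinf :=
    fun R η hη => hφ₂.tendsto_atTop.eventually (hBM R η hη)
  have hnearψ : ∀ k : ℕ, Near (↑(Y (ψ k)) : Set E3) 0 k (t' (ψ k)) (A (ψ k)) (1 / 40) := by
    intro k
    refine near_of_ball_subset (hnearY (ψ k)) ?_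
    rw [dist_self, zero_add]
    exact_mod_cast hψ.id_le k
  -- the limit datum is admissible with hcp-like inner displacement
  have hAinf : Adm Ainf := adm_of_tendsto (fun k => hA (ψ k)) hlimA
  have hIinf : Inner tinf Ainf := inner_of_tendsto (fun k => hIY (ψ k)) hlimA hlimt
  -- the limit set is globally coarsely matched and force balanced
  have hNearinf : ∀ (cc : E3) (r : ℝ), Near Yinf cc r tinf Ainf (1 / 40) :=
    near_of_limit hδ (fun k => hA (ψ k)) hAinf hnearψ hsepinf hlimA hlimt hBMψ
  have hEquil : ∀ p ∈ Yinf, HasSum (fun q : {q : E3 // q ∈ Yinf ∧ q ≠ p} =>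
      (deriv lennardJones (dist p q.1) / dist p q.1) • (p - q.1)) 0 := by
    intro p hp
    refine hasSum_force_of_forall_exists_ballMatch hδ hδ1 hsepinf (fun R η hη => ?_) hp
    obtain ⟨k, hk⟩ := (hBMψ R η hη).exists
    exact ⟨Y (ψ k), hsepY _, hbalY _, hk⟩
  -- coarse Liouville: the limit is an exact two-lattice, finely matched by `Y (ψ k)`: contradiction
  obtain ⟨t'', A'', hA'', hYeq⟩ := hHL hPS δ hδ Yinf hsepinf hEquil tinf Ainf hAinf hIinf hNearinf
  obtain ⟨k, hk⟩ := (hBMψ ρ ε hε).exists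
  exact hfailY (ψ k) t'' A'' hA'' (near_of_ballMatch_sites hYeq hk)

end Summit.AtomisticToContinuum.Crystallization.Theorems

end
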